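import Summits.BirchSwinnertonDyer.Rank1Residual.X2.NonPrimitiveLambdaShiftRat
import Summits.BirchSwinnertonDyer.Rank1Residual.X2.NonPrimitiveLambdaInvariantOfDatum
import Summits.BirchSwinnertonDyer.Rank1Residual.X2.ResidualDevissageGoodOrdinary
import HarnessLib

/-!
# GV (6)–(7) at an odd GOOD ORDINARY prime, UPPER HALF, with NO datum record:
# `λ(Sel^{Σ₀}) ≤ λ(Sel) + Σ_{v∈Σ₀} δ_E^{(v)}` for BAD `Σ₀ ∌ p`, and the `E`-side of GV (16) as an
# inequality — cell `b2b-bsdres`, unit `b2b-bsdres-eisenstein-p2`, gen 30 (F8a)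

HONEST FRAMING (run/shared/lean/b2b/bsd-rank1-residual/, verbatim in every file): the goal of the
cell is to DELETE the COMBINATION-SHAPED residual classes of the Birch–Swinnerton-Dyer formula for
ALL analytic-rank `≤ 1` elliptic curves over `ℚ` — "full BSD formula for every rank `≤ 1` curve in
class `C`" assembled STRICTLY from published theorems — so that the rank-`≤ 1` remainder becomes
exactly the CONSTRUCTION-SHAPED classes, which are TYPED (missing-input `Prop`s), NOT attempted.
This is not "finishing BSD". Research route; NO CLAIM BEYOND STATED CLASSES; nothing here changes a
label. Theorems only; no definition, no named fact, no `sorry`.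

WHAT. The printed setting of GV Thm. (1.3) (good ordinary `p`, registry A14) is derived in the tree
(`GreenbergVatsalThm13PeriodFree`) from eight registered facts, one of them A115 (GV (6)–(7):
`λ(Sel^{Σ₀}) = λ(Sel) + Σδ`) or, equivalently, the datum record T-GV23L. As in the multiplicative case
(gen 30, `NonPrimitiveLambdaLe*` / `GreenbergSelmerCountLe`), only the UPPER HALF is load-bearing,
the lower half being Wuthrich's divisibility `char X ∣ (L_p)` (already a binder, `hW16`). The kernel
theorem `NonPrimitiveLambdaShiftRat.lambdaInvariant_le_add_sum_delta_of_not_good` holds for ANY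
Greenberg datum above `p`, in particular for Greenberg's reduction datum `C = ker(E[p^∞] → Ẽ)`:

* **`lambda_nonPrimitive_le_add_sum_delta_goodOrd`** — the `≤` half of A115 for BAD `Σ₀`, from
  `hGV` (GV p. 26, `im κ_𝔭 ⊇ L_𝔭`, p221999) and A40/A41 (`hT`, `hT'`, the local structure at the
  multiplicative places of `Σ₀`): gen 26's transport `Sel = S_A`, `Sel^{Σ₀} = S^{Σ₀}_A` fed with the
  kernel bound instead of `h23`;
* `finite_and_natCard_torsionBy_nonPrimitiveSelmerInfty_le_pow`, `natCard_gvSelmerInfty_inf_torsionBy_le_pow`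
  — `#Sel^{Σ₀}[p] ≤ p^{λ(D)+Σδ}` (divisibility A116 `hB`);
* **`natCard_line_mul_quotSelmer_le_of_goodOrd`** — GV (16), `E`-side, `≤`, at a good ordinary prime.

References: [GreenbergVatsal2000] §1 (6)–(7), §2 Cor. (2.3), Prop. (2.4), pp. 25–30, display (16);
[GreenbergLNM1716] §2 Props. 2.2–2.4; HOME/b2b-bsdres-eisenstein-p2/X2-GAP.md §35.
-/

set_option autoImplicit false

noncomputable section

open scoped Classical AddSubgroup

namespace Summit.BirchSwinnertonDyer.Rank1Residual.X2.NonPrimitiveLambdaLeGoodOrdinary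

open NumberField IsDedekindDomain Field WeierstrassCurve
  Literature.NumberTheory.EllipticCurves Literature.NumberTheory.EllipticCurves.GreenbergSelmer
  Literature.NumberTheory.EllipticCurves.GreenbergVatsal2000
  Literature.NumberTheory.GaloisRepresentations
  Literature.NumberTheory.EllipticCurves.Rank1Residual
  Summit.BirchSwinnertonDyer.Rank1Residual.X2.GreenbergVatsalTorsion
  Summit.BirchSwinnertonDyer.Rank1Residual.X2.GreenbergVatsalReductionDatum
  Summit.BirchSwinnertonDyer.Rank1Residual.X2.GreenbergVatsalStrictAtP
  Summit.BirchSwinnertonDyer.Rank1Residual.X2.NonPrimitiveLambdaInvariantOfDatum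
  Summit.BirchSwinnertonDyer.Rank1Residual.X2.NonPrimitiveSelmerGVEquality
  Summit.BirchSwinnertonDyer.Rank1Residual.X2.NonPrimitiveSelmerTorsionCard
  Summit.BirchSwinnertonDyer.Rank1Residual.X2.CongruentLambdaShiftDerived
  Summit.BirchSwinnertonDyer.Rank1Residual.X2.ResidualDevissageModules
  Summit.BirchSwinnertonDyer.Rank1Residual.X2.ResidualDevissageSelmer
  Summit.BirchSwinnertonDyer.Rank1Residual.X2.ResidualDevissageLine
  Summit.BirchSwinnertonDyer.Rank1Residual.X2.ResidualDevissageNoTorsion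
  Summit.BirchSwinnertonDyer.Rank1Residual.X2.ResidualDevissageGoodOrdinary

open WeierstrassCurve (minimalDiscriminantInt)

/-! ## §1. The `≤` half of A115 for bad `Σ₀`, without the datum record -/

/-- **GV (6)–(7) at a good ordinary prime, UPPER HALF, NO datum record**: `E/ℚ` globally minimal,
`p` odd good ordinary, `κ` cyclotomic with topological generator `γ`, `Σ₀` a finite set of BAD places
`∌ p`, `D` a f.g. torsion dual datum of `Sel_E(ℚ_∞)_p`, `DS` a dual datum of `Sel^{Σ₀}_E(ℚ_∞)_p`:
`DS` f.g., torsion, `μ(DS) = μ(D)` and `λ(DS) ≤ λ(D) + Σ_{v∈Σ₀} δ_E^{(v)}`. Proof: gen 26's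
`lambda_nonPrimitive_eq_add_sum_delta_of_datum` verbatim (Greenberg's reduction datum, `Sel = S_A`,
`Sel^{Σ₀} = S^{Σ₀}_A` by `hGV` and the bad-place equalities), with the kernel theorem
`NonPrimitiveLambdaShiftRat.lambdaInvariant_le_add_sum_delta_of_not_good` (A40/A41 at the
multiplicative places of `Σ₀`) in place of T-GV23L.
[cite: GreenbergVatsal2000, §1 (6)–(7) pp. 7–8; §2 Cor. (2.3), Prop. (2.4) (pp. 20–22); p. 26]
[cite: GreenbergLNM1716, §2 Props. 2.2, 2.4 (pp. 73–75)] -/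
theorem lambda_nonPrimitive_le_add_sum_delta_goodOrd (hGV : imKummer_ge_greenbergCondition_at_p)
    (hT : Silverman1994_thmV53_tateUniformisation.{0})
    (hT' : Silverman1994_thmV53_corV54_tateUniformisation.{0})
    (W : WeierstrassCurve ℚ) [W.IsElliptic] [W.IsGloballyMinimal] (p : ℕ) [Fact p.Prime]
    (hp2 : p ≠ 2) (hgood : W.HasGoodReductionAtPrime p) (hord : ¬ (p : ℤ) ∣ W.frobeniusTrace p)
    (κ : ZpExtension ℚ p) (hκ : κ.IsCyclotomic) (γ : absoluteGaloisGroup ℚ)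
    (hγ : κ.IsTopGenerator γ) (S₀ : Finset (HeightOneSpectrum (𝓞 ℚ)))
    (hS₀ : ∀ v ∈ S₀, ((p : ℕ) : 𝓞 ℚ) ∉ v.asIdeal) (hbad : ∀ v ∈ S₀, ¬ W.HasGoodReductionAt v)
    (D : W.SelmerDualData κ γ) [Module.Finite (IwasawaAlgebra p) D.X]
    (DS : NonPrimitiveDualData W κ γ (↑S₀ : Set (HeightOneSpectrum (𝓞 ℚ)))) (hX : D.IsTorsion) :
    Module.Finite (IwasawaAlgebra p) DS.X ∧ Module.IsTorsion (IwasawaAlgebra p) DS.X ∧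
      muInvariant p DS.X = muInvariant p D.X ∧
      lambdaInvariant p DS.X ≤ lambdaInvariant p D.X + ∑ v ∈ S₀, delta W p v := by
  have hΔ : ¬ (p : ℤ) ∣ minimalDiscriminantInt W :=
    W.not_dvd_minimalDiscriminantInt_of_hasGoodReductionAtPrime' p hgood
  -- Greenberg's reduction data above `p`: the classical condition is the Greenberg condition
  have hRD : ∀ (v : HeightOneSpectrum (𝓞 ℚ)) (hv : ((p : ℕ) : 𝓞 ℚ) ∈ v.asIdeal),
      (reductionData W p hΔ v hv).greenbergKer κ.kerSubgroup =
        W.localKerOver p κ.kerSubgroup (v.adicCompletion ℚ) :=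
    fun v hv ↦ (localKerOver_eq_greenbergKer_and_strictKer W p κ hGV hκ hv hΔ hord).1.symm
  -- classical = datum, primitive and non-primitive
  have hSel : W.selmerInfty κ = datumSelmerInfty κ (W.geomPrimaryTorsion p) (reductionData W p hΔ) ∅ :=
    Additive.selmerInfty_eq_datumSelmerInfty W p κ hp2 hκ (reductionData W p hΔ) hRD
  have hNP : nonPrimitiveSelmerInfty W κ (↑S₀ : Set (HeightOneSpectrum (𝓞 ℚ))) =
      datumSelmerInfty κ (W.geomPrimaryTorsion p) (reductionData W p hΔ)
        (↑S₀ : Set (HeightOneSpectrum (𝓞 ℚ))) :=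
    Additive.nonPrimitiveSelmerInfty_eq_datumSelmerInfty W p κ _ hp2 hκ (reductionData W p hΔ) hRD
      (fun v hv ↦ hS₀ v (Finset.mem_coe.1 hv))
  -- transport the duals, apply the kernel upper bound, transport back
  obtain ⟨X, ⟨eX⟩⟩ := exists_datumDualData_of_selmerDualData W D hSel
  obtain ⟨X₀, ⟨eX₀⟩⟩ := exists_datumDualData_of_nonPrimitiveDualData W DS hNP
  haveI : Module.Finite (IwasawaAlgebra p) X.X := Module.Finite.equiv eX.symm
  have hXt : Module.IsTorsion (IwasawaAlgebra p) X.X :=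
    isTorsion_of_injective eX.toLinearMap eX.injective hX
  obtain ⟨hfg, htors, hμ, hlam⟩ :=
    NonPrimitiveLambdaShiftRat.lambdaInvariant_le_add_sum_delta_of_not_good W κ hT hT' hp2 hκ hγ
      (reductionData W p hΔ) S₀ hS₀ hbad X hXt X₀
  haveI := hfg
  refine ⟨Module.Finite.equiv eX₀, isTorsion_of_injective eX₀.symm.toLinearMap eX₀.symm.injective htors,
    ?_, ?_⟩
  · rw [← muInvariant_eq_of_linearEquiv eX₀, hμ, muInvariant_eq_of_linearEquiv eX]
  · rw [← lambdaInvariant_eq_of_linearEquiv eX₀, ← lambdaInvariant_eq_of_linearEquiv eX]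
    exact hlam

/-! ## §2. `#Sel^{Σ₀}[p] ≤ p^{λ(E) + Σδ}` at `μ = 0` -/

section OneCurve

variable (W : WeierstrassCurve ℚ) [W.IsElliptic] [W.IsGloballyMinimal] {p : ℕ} [hp : Fact p.Prime]
  {κ : ZpExtension ℚ p} {γ : absoluteGaloisGroup ℚ} (S₀ : Finset (HeightOneSpectrum (𝓞 ℚ)))

/-- **`Sel^{Σ₀}_E(ℚ_∞)_p[p]` is finite of order `≤ p ^ (λ(E) + Σ_{v∈Σ₀} δ_E^{(v)})`** (`p` odd good
ordinary, `κ` cyclotomic, BAD `Σ₀ ∌ p` containing the bad places, `D` f.g. torsion with `μ = 0`):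
§1 at the kernel's dual datum of `Sel^{Σ₀}` + divisibility (A116 `hB`) + the Pontryagin count
`#S[p] = p^{λ(X)}` — gen 11's `finite_and_natCard_torsionBy_nonPrimitiveSelmerInfty_eq_pow` with `≤`.
[cite: GreenbergVatsal2000, §1 (7) and p. 8] -/
theorem finite_and_natCard_torsionBy_nonPrimitiveSelmerInfty_le_pow
    (hGV : imKummer_ge_greenbergCondition_at_p)
    (hT : Silverman1994_thmV53_tateUniformisation.{0})
    (hT' : Silverman1994_thmV53_corV54_tateUniformisation.{0})
    (hB : divisible_nonPrimitiveSelmerInfty_of_mu_eq_zero)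
    (hp2 : p ≠ 2) (hgood : W.HasGoodReductionAtPrime p) (hord : ¬ (p : ℤ) ∣ W.frobeniusTrace p)
    (hκ : κ.IsCyclotomic) (hγ : κ.IsTopGenerator γ)
    (hS₀ : ∀ v ∈ S₀, ((p : ℕ) : 𝓞 ℚ) ∉ v.asIdeal) (hbad : ∀ v ∈ S₀, ¬ W.HasGoodReductionAt v)
    (hS : ∀ v : HeightOneSpectrum (𝓞 ℚ), v ∉ S₀ → ((p : ℕ) : 𝓞 ℚ) ∉ v.asIdeal →
      W.HasGoodReductionAt v)
    (D : W.SelmerDualData κ γ) [Module.Finite (IwasawaAlgebra p) D.X] (hX : D.IsTorsion)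
    (hμ : D.mu = 0) :
    Finite ((nonPrimitiveSelmerInfty W κ (↑S₀ : Set (HeightOneSpectrum (𝓞 ℚ))))[(p : ℤ)]) ∧
      Nat.card ((nonPrimitiveSelmerInfty W κ (↑S₀ : Set (HeightOneSpectrum (𝓞 ℚ))))[(p : ℤ)]) ≤
        p ^ (lambdaInvariant p D.X + ∑ v ∈ S₀, delta W p v) := by
  set DS := NonPrimitiveSelmerDual.nonPrimitiveDualData W κ (↑S₀ : Set (HeightOneSpectrum (𝓞 ℚ))) hγ
    with hDS
  obtain ⟨hfg, htors, hmu, hlam⟩ :=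
    lambda_nonPrimitive_le_add_sum_delta_goodOrd hGV hT hT' W p hp2 hgood hord κ hκ γ hγ S₀ hS₀ hbad D
      DS hX
  haveI := hfg
  have hμS : muInvariant p DS.X = 0 := by rw [hmu]; exact hμ
  have hdiv : ∀ s : nonPrimitiveSelmerInfty W κ (↑S₀ : Set (HeightOneSpectrum (𝓞 ℚ))),
      ∃ t : nonPrimitiveSelmerInfty W κ (↑S₀ : Set (HeightOneSpectrum (𝓞 ℚ))), p • t = s := by
    intro s
    obtain ⟨t, ht, hts⟩ := hB W p hp2 hgood hord κ hκ γ hγ S₀ hS₀ (fun v hv hpv ↦ hS v hv hpv)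
      D hX hμ s s.2
    exact ⟨⟨t, ht⟩, Subtype.ext (by rw [AddSubgroupClass.coe_nsmul]; exact hts)⟩
  obtain ⟨hfin, hcard⟩ := finite_and_natCard_torsionBy_eq_pow_lambdaInvariant_of_divisible p DS.X
    htors hμS hdiv (NonPrimitiveSelmerDual.toDualEquiv W κ _ DS)
  exact ⟨hfin, hcard ▸ Nat.pow_le_pow_right hp.out.pos hlam⟩

/-- **The same for the kernel's object** `S^{Σ₀}_{E[p^∞]}(ℚ_∞) ⊓ H¹(ℚ_∞, E[p^∞])[p]` of Greenberg's
reduction data: `#(S^{Σ₀} ⊓ H¹[p]) ≤ p ^ (λ(E) + Σ_{v∈Σ₀} δ_E^{(v)})`, via `Sel^{Σ₀} = S^{Σ₀}` (`hGV`).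
[cite: GreenbergVatsal2000, §1 (7), p. 8 and §2 p. 26] -/
theorem natCard_gvSelmerInfty_inf_torsionBy_le_pow (hGV : imKummer_ge_greenbergCondition_at_p)
    (hT : Silverman1994_thmV53_tateUniformisation.{0})
    (hT' : Silverman1994_thmV53_corV54_tateUniformisation.{0})
    (hB : divisible_nonPrimitiveSelmerInfty_of_mu_eq_zero)
    (hp2 : p ≠ 2) (hgood : W.HasGoodReductionAtPrime p) (hord : ¬ (p : ℤ) ∣ W.frobeniusTrace p)
    (hκ : κ.IsCyclotomic) (hγ : κ.IsTopGenerator γ)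
    (hS₀ : ∀ v ∈ S₀, ((p : ℕ) : 𝓞 ℚ) ∉ v.asIdeal) (hbad : ∀ v ∈ S₀, ¬ W.HasGoodReductionAt v)
    (hS : ∀ v : HeightOneSpectrum (𝓞 ℚ), v ∉ S₀ → ((p : ℕ) : 𝓞 ℚ) ∉ v.asIdeal →
      W.HasGoodReductionAt v)
    (D : W.SelmerDualData κ γ) [Module.Finite (IwasawaAlgebra p) D.X] (hX : D.IsTorsion)
    (hμ : D.mu = 0) (hΔ : ¬ (p : ℤ) ∣ minimalDiscriminantInt W) :
    Nat.card (gvSelmerInfty κ (W.geomPrimaryTorsion p) (reductionData W p hΔ)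
        (↑S₀ : Set (HeightOneSpectrum (𝓞 ℚ))) ⊓
        (subgroupH1 κ.kerSubgroup (W.geomPrimaryTorsion p))[(p : ℤ)] :
        AddSubgroup (subgroupH1 κ.kerSubgroup (W.geomPrimaryTorsion p))) ≤
      p ^ (lambdaInvariant p D.X + ∑ v ∈ S₀, delta W p v) := by
  rw [← natCard_torsionBy_nonPrimitiveSelmerInfty_eq W p κ _ hGV hp2 hΔ hord hκ hS₀ hS]
  exact (finite_and_natCard_torsionBy_nonPrimitiveSelmerInfty_le_pow W S₀ hGV hT hT' hB hp2 hgood hord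
    hκ hγ hS₀ hbad hS D hX hμ).2

end OneCurve

/-! ## §3. GV (16) at a good ordinary prime, `E`-side, upper half -/

section Devissage

variable (W : WeierstrassCurve ℚ) [W.IsGloballyMinimal] [W.IsElliptic] (p : ℕ) [hp : Fact p.Prime]
  (κ : ZpExtension ℚ p) {γ : absoluteGaloisGroup ℚ} (S₀ : Finset (HeightOneSpectrum (𝓞 ℚ)))
  {Φ₀ : AddSubgroup (W.geomTorsion (p : ℤ))} (hΦ : IsRationalLine W p Φ₀)

/-- **GV (16) at a GOOD ORDINARY odd `p`, `E`-side, upper half:**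
`#H¹(ℚ_Σ/ℚ_∞, Φ₀) · #S^{Σ₀}_{E[p]/Φ₀}(ℚ_∞) ≤ p^{λ(E) + Σ_{v∈Σ₀} δ_v}` for a rational line `Φ₀`
ramified at `p` and even, `μ(E) = 0`, BAD `Σ₀ ∌ p` containing the bad places — gen 19's
`natCard_line_mul_quotSelmer_eq_of_goodOrd` with A115 replaced by §2 (inputs `hGV`, A40/A41, A116,
the lifting property). [cite: GreenbergVatsal2000, §2 pp. 25–30 (display (16)), Prop. (2.8)]
[cite: GreenbergLNM1716, §1 p. 62, §2 pp. 70–75] -/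
theorem natCard_line_mul_quotSelmer_le_of_goodOrd
    (hGV : imKummer_ge_greenbergCondition_at_p)
    (hT : Silverman1994_thmV53_tateUniformisation.{0})
    (hT' : Silverman1994_thmV53_corV54_tateUniformisation.{0})
    (hB : divisible_nonPrimitiveSelmerInfty_of_mu_eq_zero)
    (hκ : κ.IsCyclotomic) (hγ : κ.IsTopGenerator γ) (hp2 : p ≠ 2)
    (hgood : W.HasGoodReductionAtPrime p) (hord : ¬ (p : ℤ) ∣ W.frobeniusTrace p)
    (hΔ : ¬ (p : ℤ) ∣ minimalDiscriminantInt W)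
    (hS₀ : ∀ v ∈ S₀, ((p : ℕ) : 𝓞 ℚ) ∉ v.asIdeal) (hbad : ∀ v ∈ S₀, ¬ W.HasGoodReductionAt v)
    (hS : ∀ v : HeightOneSpectrum (𝓞 ℚ), v ∉ S₀ → ((p : ℕ) : 𝓞 ℚ) ∉ v.asIdeal →
      W.HasGoodReductionAt v)
    (D : W.SelmerDualData κ γ) [Module.Finite (IwasawaAlgebra p) D.X] (hX : D.IsTorsion)
    (hμ : D.mu = 0) (hram : ¬ LineUnramifiedAt W p Φ₀) (heven : LineEven W p Φ₀)
    (hlift : ∀ s ∈ ResidualDevissageSelmer.quotSelmer κ.kerSubgroup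
        (ResidualDevissageLine.lineSub Φ₀ hΦ).Quot p (↑S₀ : Set (HeightOneSpectrum (𝓞 ℚ))),
      ∃ x ∈ GreenbergVatsal2000.unramifiedOutside κ.kerSubgroup
          ↥((↥(W.geomPrimaryTorsion p))[(p : ℤ)]) p (↑S₀ : Set (HeightOneSpectrum (𝓞 ℚ))),
        ResidualDevissageSelmer.subH1 κ.kerSubgroup (ResidualDevissageLine.lineSub Φ₀ hΦ).proj
          (ResidualDevissageLine.lineSub Φ₀ hΦ).proj_smul x = s) :
    Nat.card (GreenbergVatsal2000.unramifiedOutside κ.kerSubgroup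
        (ResidualDevissageLine.lineSub Φ₀ hΦ).Sub p (↑S₀ : Set (HeightOneSpectrum (𝓞 ℚ)))) *
      Nat.card (ResidualDevissageSelmer.quotSelmer κ.kerSubgroup
        (ResidualDevissageLine.lineSub Φ₀ hΦ).Quot p (↑S₀ : Set (HeightOneSpectrum (𝓞 ℚ)))) ≤
    p ^ (lambdaInvariant p D.X + ∑ v ∈ S₀, delta W p v) := by
  have hS' : ∀ v : HeightOneSpectrum (𝓞 ℚ), v ∉ (↑S₀ : Set (HeightOneSpectrum (𝓞 ℚ))) →
      ((p : ℕ) : 𝓞 ℚ) ∉ v.asIdeal → W.HasGoodReductionAt v :=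
    fun v hv hpv ↦ hS v (fun h ↦ hv (Finset.mem_coe.2 h)) hpv
  obtain ⟨c, hc⟩ := exists_isComplexConjugation (Rat.castHom ℝ)
  have hdev := ResidualDevissageLine.natCard_gvSelmer_torsion_eq_mul_of_line hΦ hp2 hram heven
    (reductionData W p hΔ) (reductionData_htriv W p hΔ)
    (natCard_reductionData_plus_inf_torsionBy W p hΔ hord) (↑S₀ : Set (HeightOneSpectrum (𝓞 ℚ)))
    hS' κ.kerSubgroup (ResidualDevissageLine.mem_kerSubgroup_of_isComplexConjugation κ hc) hc hlift
  have h28 := GreenbergVatsalTorsionCurve.natCard_gvSelmer_torsion_curve W p κ.kerSubgroup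
    (reductionData W p hΔ) (↑S₀ : Set (HeightOneSpectrum (𝓞 ℚ))) hS' (reductionData_htriv W p hΔ)
  rw [← hdev, h28, natCard_fixedPoints_quot_eq_one_of_line_goodOrd W p κ hΦ hp2 hgood hord hκ hram
    heven, mul_one]
  change Nat.card ↥(gvSelmerInfty κ (W.geomPrimaryTorsion p) (reductionData W p hΔ) ↑S₀ ⊓ _) ≤ _
  exact natCard_gvSelmerInfty_inf_torsionBy_le_pow W S₀ hGV hT hT' hB hp2 hgood hord hκ hγ hS₀ hbad hS
    D hX hμ hΔ

end Devissage

end Summit.BirchSwinnertonDyer.Rank1Residual.X2.NonPrimitiveLambdaLeGoodOrdinary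

end
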